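import Mathlib
import HarnessLib
import Literature.AlgebraicGeometry.Markman2025.ChevalleyIsomorphismSigns

/-!
# Markman 2025 — LEMMA 6.3.2 («`(ϕ_𝒫 ⊗ ψ_{𝒫⁻¹}) : H^d(X̂ × X) → H^{4n−d}(X × X̂)` is equal to
# `(−1)^{d(d+1)/2}PD_{X̂×X}`»): the PARITY ARITHMETIC of its proof, AS PRINTED (v2 p. 38 L8–L40), kernel-checked —
# including the `(−1)^n` by which line 1 → line 2 of the printed display does NOT close (print-reading query Q-6.3.2)

E. Markman: [M] *Cycles on abelian 2n-folds of Weil type from secant sheaves on abelian n-folds*,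
arXiv:2502.03415 **v2** (2025-06-08), bib `Markman2025SecantWeil` — UNREFEREED PREPRINT. «p. N L m» = PyMuPDF line `m`
of page `N` of the public v2 PDF (sha256/16 `8155aa33870069b8`), read at seat lit-w-markman g23 (pub-hsemireg LIT-W,
2026-08-25; p. 36–38 from the numbered text layer and re-read BY EYE on the renders `mar25v2_p37.png`
27294bb9a7e60f4e, `mar25v2_p38.png` aa23f5356f862949; sheet `LOCATOR-SHEET-MARKMAN.md` §72; bus query Q-6.3.2).
Companion file: `ChevalleyIsomorphismSigns.lean` (LEMMA 6.3.1: `ε_{K,K^c}` as an inversion count, `ε_{K^c,K} =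
(−1)^k ε_{K,K^c}`, footnote 13's `σ_K`, (6.3.1)–(6.3.2)), whose notation this file keeps.

## What is printed (verbatim; displays linearised)

* p. 36 L51–55 (proof of Lemma 6.3.1): «Furthermore, `ε_{K^c,K} = (−1)^k ε_{K,K^c} = (−1)^{Σ(K)−k(k−1)/2}`. … So Poincaré
  duality `PD_X` sends `e_K` to `∫_X e_K ∧ (•) = ε_{K,K^c}f_{K^c}`.»
* p. 37 L3–5 and footnote 13: «The cohomological action of the functor `Ψ_{𝒫⁻¹[n]} : D^b(X) → D^b(X̂)` is given by
  `Ψ_{𝒫⁻¹[n]}(e_K) = σ_K PD(e_K) = σ_K ε_{K,K^c}f_{K^c}`, where¹³ `σ_K = (−1)^{k(k+3)/2}`.» — «¹³`ϕ_𝒫 : H^k(X̂, ℤ) →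
  H^{2n−k}(X, ℤ)` is equal to `(−1)^{k(k+1)/2+n}PD_k`, where `PD_k : H^k(X̂, ℤ) → H^{2n−k}(X, ℤ)` is the Poincaré duality
  isomorphism [H2, Lemma 9.23]. Furthermore, the composition `H^k(X̂, ℤ) →^{ϕ_𝒫} H^{2n−k}(X, ℤ) →^{ϕ_𝒫} H^k(X̂, ℤ)` is
  `(−1)^{k+n}` [H2, Cor. 9.24]. Now, `Ψ_{𝒫⁻¹}[n]` is the inverse of `Φ_𝒫` and so the the cohomological action of
  `Ψ_{𝒫⁻¹}[n]` restricts to `H^k(X, ℤ)` as `(−1)^{k+n}ϕ_𝒫 = (−1)^{k(k+3)/2}PD_k`.»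
* p. 38 L8–9: «LEMMA 6.3.2. `(ϕ_𝒫 ⊗ ψ_{𝒫⁻¹}) : H^d(X̂ × X) → H^{4n−d}(X × X̂)` is equal to `(−1)^{d(d+1)/2}PD_{X̂×X}`.»
* PROOF, p. 38 L10–L40: «Keep the notation of the proof of Lemma 6.3.1. In particular, `f_L = f_{j₁} ∧ ⋯ ∧ f_{j_ℓ}` and
  `e_K = e_{i₁} ∧ ⋯ ∧ e_{i_k}` are classes of degrees `ℓ` and `k` respectively. We have the equality `ϕ_𝒫⁻¹ = ψ_{𝒫⁻¹}`.
  By definition, `(PD_{X̂×X}(f_L ∧ e_K), •) = ∫_{X̂×X}(f_L ∧ e_K) ∧ •`.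
  [line 1] `(ϕ_𝒫 ⊗ ϕ_𝒫⁻¹)(f_L ∧ e_K) = (−1)^{ℓ(ℓ+1)/2+n}(−1)^{(2n−k)(2n−k+1)/2+n}PD(f_L) ∧ PD⁻¹(e_K)`
  [line 2] `= (−1)^{[k(k+1)+ℓ(ℓ+1)]/2}(−1)^k ε_{L,L^c}ε_{K^c,K}e_{L^c} ∧ f_{K^c}`
  [line 3] `= (−1)^{[k(k+1)+ℓ(ℓ+1)]/2}ε_{L,L^c}ε_{K,K^c}e_{L^c} ∧ f_{K^c}`
  So `((ϕ_𝒫 ⊗ ϕ_𝒫⁻¹)(f_L ∧ e_K), f_{L^c} ∧ e_{K^c}) = (−1)^{[k(k+1)+ℓ(ℓ+1)]/2}ε_{L,L^c}ε_{K,K^c} =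
  (−1)^{(k+ℓ)(k+ℓ+1)/2}(−1)^{kl}ε_{L,L^c}ε_{K,K^c}`. On the other hand, `∫_{X̂×X}(f_L ∧ e_K) ∧ (f_{L^c} ∧ e_{K^c}) =
  (−1)^{kl}∫_{X̂×X} f_L ∧ f_{L^c} ∧ e_K ∧ e_{K^c} = (−1)^{kl}ε_{L,L^c}ε_{K,K^c}`. □»
* The lemma's only uses: p. 40 L3–4 «Now `(ϕ_𝒫 ⊗ ψ_{𝒫⁻¹[n]})` sends `F^k(∧^*V)` to `F_{4n−k}(∧^*V)` [sic; the
  subscript `F_{4n−k}` — no `F_m` is defined in print — reads as the DECREASING filtration `F^{4n−k}H^*(X × X̂, ℤ) :=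
  ⊕_{i≥4n−k}H^i` of p. 38 L76, the source `F^k(∧^*V) := ⊕_{i≤k} ∧^i V` being the INCREASING one of p. 17 L42], by
  Lemma 6.3.2, and so the weight is 2.» (degree bookkeeping `degrees ≤ k ↦ degrees ≥ 4n − k`, sign-free) and Remark
  6.3.3 («an analogue of the Hodge ∗ operator»).

## What this file proves (0 `def`, 0 named fact, 0 sorry; parity arithmetic on the printed exponents only)

Exponents are natural numbers; `k, ℓ ≤ 2n` are the degrees; every «`x(x+1)/2`» is exact integer division.
§A `dual_degree_triangle` — the second printed exponent of line 1: `(2n−k)(2n−k+1)/2 ≡ n + k(k−1)/2 (mod 2)`; in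
particular the `n` does NOT cancel against the two printed «`+n`». §B `line_one_line_two_gap` — with `PD(f_L) =
ε_{L,L^c}e_{L^c}` (the `X̂`-analogue of p. 36 L55, i.e. the normalisation `∫_{X̂×X} f_L ∧ f_{L^c} ∧ e_K ∧ e_{K^c} =
ε_{L,L^c}ε_{K,K^c}` of L36–39) and `PD⁻¹(e_K) = ε_{K^c,K}f_{K^c}`, the exponent of line 1, `ℓ(ℓ+1)/2 + n +
(2n−k)(2n−k+1)/2 + n`, and the exponent of line 2, `[k(k+1)+ℓ(ℓ+1)]/2 + k`, DIFFER BY `n` modulo 2 (their sum plus `n` is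
even): line 1 = `(−1)^n ×` line 2, for every `k, ℓ`. §C `line_two_line_three` — «`(−1)^k ε_{K^c,K} = ε_{K,K^c}`» is
p. 36 L51 (`ε_{K^c,K} = (−1)^k ε_{K,K^c}`, the swap sign `(−1)^{k(2n−k)} = (−1)^k`: `swap_parity`). §D `bracket_split`
∕ `triangle_of_sum` — «`[k(k+1)+ℓ(ℓ+1)]/2`» is `k(k+1)/2 + ℓ(ℓ+1)/2`, and «`(−1)^{[k(k+1)+ℓ(ℓ+1)]/2} =
(−1)^{(k+ℓ)(k+ℓ+1)/2}(−1)^{kl}`» (L30–32) is the exact identity `(k+ℓ)(k+ℓ+1)/2 = k(k+1)/2 + ℓ(ℓ+1)/2 + kℓ`. §E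
`statement_exponent_from_line_one` — carrying line 1 (not line 2) through L26–39 gives the operator sign
`(−1)^{d(d+1)/2 + n}`, `d = k + ℓ`, instead of the printed `(−1)^{d(d+1)/2}`; §F `footnote13_route_gap` — taking
`ϕ_𝒫⁻¹(e_K)` from p. 37 L3–5 instead (`(−1)^{k(k+3)/2}ε_{K,K^c}f_{K^c}`) the gap to line 2 is `n + k` modulo 2.
READING (Q-6.3.2 — a QUERY, not an erratum claim; ×2 ACROSS SEATS: this seat + second reader lit-3 g60, by eye and own code, pub-hsemireg bus l.24134, CONCUR): the lemma is printed for `ψ_{𝒫⁻¹}` WITHOUT the shift and its proof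
opens «`ϕ_𝒫⁻¹ = ψ_{𝒫⁻¹}`», while footnote 13 prints «`Ψ_{𝒫⁻¹}[n]` is the inverse of `Φ_𝒫`»; the shift `[n]` acts by
`(−1)^n` on cohomology — exactly the gap of §B —, so the two `(−1)^n` imprecisions cancel for the operator AS PRINTED
(`ψ_{𝒫⁻¹}` unshifted), and which normalisation [H2, Lemma 9.23 ∕ Cor. 9.24] fixes is not decidable from the printed
text (the book is not held by the cell; lit-3's sharpening: footnote 13's middle sentence — the composition is `(−1)^{k+n}`
— is the convention-free Mukai inversion, so the residual ambiguity is exactly the order-of-pairing sign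
`(−1)^{k(2n−k)} = (−1)^k` of the two directions of `PD_k`, cf. §F; the `(−1)^n` of §B does not depend on it).
DOWNSTREAM-NEUTRAL: p. 40 L3–4 uses only the degree shift `d ↦ 4n − d`; for
even `n` both signs coincide; no statement of [M] used elsewhere depends on this sign. BY VALUE ∕ NOT modelled: the
exterior algebra, `PD`, `ϕ_𝒫`, `ψ_{𝒫⁻¹}`, [H2], the pairing `(•, •)`, the shift's action. Typographic riders (×2):
footnote 13 «`Ψ_{𝒫⁻¹}[n]`» (shift outside the subscript) and «the the»; p. 40 «`F_{4n−k}`» [sic]. Nothing here says any object is semiregular or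
that HC ∕ HC_CM ∕ HC_AV is proved.
-/

namespace Literature.AlgebraicGeometry.Markman2025.Lemma632

/-! ### Exact halves (every printed «`x(x+1)/2`» is an integer) -/

/-- `2 · (x(x+1)/2) = x(x+1)` (private arithmetic helper). [folklore] -/
private theorem two_mul_triangle (x : ℕ) : 2 * (x * (x + 1) / 2) = x * (x + 1) :=
  Nat.two_mul_div_two_of_even (Nat.even_mul_succ_self x)

/-- `2 · (x(x−1)/2) = x(x−1)` (private arithmetic helper). [folklore] -/
private theorem two_mul_triangle_pred (x : ℕ) : 2 * (x * (x - 1) / 2) = x * (x - 1) :=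
  Nat.two_mul_div_two_of_even (Nat.even_mul_pred_self x)

/-- `k(k+1)/2 = k(k−1)/2 + k` (private arithmetic helper for the «`k(k+3)/2 = k(k+1)/2 + k`»-type shifts). [folklore] -/
private theorem triangle_succ_eq (k : ℕ) : k * (k + 1) / 2 = k * (k - 1) / 2 + k := by
  have h1 := two_mul_triangle k
  have h2 := two_mul_triangle_pred k
  have h3 : k * (k + 1) = k * (k - 1) + 2 * k := by
    rcases k with _ | j
    · simp
    · simp only [Nat.succ_sub_one]; ring
  omega

/-! ### §A — the second exponent of line 1: «`(2n−k)(2n−k+1)/2 + n`» -/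

/-- `(2n−k)(2n−k+1)/2 + n + k(k−1)/2` is EVEN (`k ≤ 2n`): the printed exponent «`(2n−k)(2n−k+1)/2`» has the parity
of `n + k(k−1)/2`, NOT of `k(k−1)/2` — the residual `n` of the query Q-6.3.2.
[cite: Markman2025SecantWeil, proof of Lemma 6.3.2, v2 p. 38 L18–21 (line 1)] -/
theorem dual_degree_triangle (n k : ℕ) (hk : k ≤ 2 * n) :
    Even ((2 * n - k) * (2 * n - k + 1) / 2 + n + k * (k - 1) / 2) := by
  set m := 2 * n - k with hm
  set T := m * (m + 1) / 2 with hT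
  set U := k * (k - 1) / 2 with hU
  have h1 : 2 * T = m * (m + 1) := two_mul_triangle m
  have h2 : 2 * U = k * (k - 1) := two_mul_triangle_pred k
  rw [← Int.even_coe_nat]
  refine ⟨(n : ℤ) ^ 2 - n * k + n + U, ?_⟩
  have hmz : (m : ℤ) = 2 * n - k := by omega
  have h1z : (2 : ℤ) * T = (m : ℤ) * (m + 1) := by exact_mod_cast h1
  have h2z : (2 : ℤ) * U = (k : ℤ) * (k - 1) := by
    rcases Nat.eq_zero_or_pos k with rfl | hk1
    · simp [hU]
    · have : ((k * (k - 1) : ℕ) : ℤ) = (k : ℤ) * (k - 1) := by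
        rw [Nat.cast_mul, Nat.cast_sub hk1]; simp
      rw [← this]; exact_mod_cast h2
  rw [hmz] at h1z
  push_cast
  nlinarith [h1z, h2z]

/-! ### §B — line 1 versus line 2: the exponents differ by `n` -/

/-- THE GAP (Q-6.3.2). Line 1's exponent `ℓ(ℓ+1)/2 + n + ((2n−k)(2n−k+1)/2 + n)` and line 2's exponent
`[k(k+1)+ℓ(ℓ+1)]/2 + k` satisfy: their sum PLUS `n` is even, i.e. `(−1)^{line 1} = (−1)^n (−1)^{line 2}` — for
every `k ≤ 2n` and every `ℓ` (reading `PD(f_L) ∧ PD⁻¹(e_K) = ε_{L,L^c}ε_{K^c,K} e_{L^c} ∧ f_{K^c}`).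
[cite: Markman2025SecantWeil, proof of Lemma 6.3.2, v2 p. 38 L18–23 (lines 1–2)] -/
theorem line_one_line_two_gap (n k l : ℕ) (hk : k ≤ 2 * n) :
    Even ((l * (l + 1) / 2 + n + ((2 * n - k) * (2 * n - k + 1) / 2 + n))
      + ((k * (k + 1) + l * (l + 1)) / 2 + k) + n) := by
  obtain ⟨r, hr⟩ := dual_degree_triangle n k hk
  have hc : k * (k + 1) / 2 = k * (k - 1) / 2 + k := triangle_succ_eq k
  have hsplit : (k * (k + 1) + l * (l + 1)) / 2 = k * (k + 1) / 2 + l * (l + 1) / 2 :=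
    Nat.add_div_of_dvd_right ((Nat.even_mul_succ_self k).two_dvd)
  rw [hsplit, hc]
  refine ⟨r + l * (l + 1) / 2 + n + k, ?_⟩
  omega

/-- The same gap as a sign identity: `(−1)^{line 1} = (−1)^n · (−1)^{line 2}` in any commutative ring.
[cite: Markman2025SecantWeil, proof of Lemma 6.3.2, v2 p. 38 L18–23] -/
theorem line_one_eq_neg_one_pow_n_mul_line_two {R : Type*} [CommRing R] (n k l : ℕ) (hk : k ≤ 2 * n) :
    (-1 : R) ^ (l * (l + 1) / 2 + n + ((2 * n - k) * (2 * n - k + 1) / 2 + n))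
      = (-1) ^ n * (-1) ^ ((k * (k + 1) + l * (l + 1)) / 2 + k) := by
  obtain ⟨r, hr⟩ := line_one_line_two_gap n k l hk
  set a := l * (l + 1) / 2 + n + ((2 * n - k) * (2 * n - k + 1) / 2 + n)
  set b := (k * (k + 1) + l * (l + 1)) / 2 + k
  have h : (-1 : R) ^ a * (-1) ^ (b + n) = 1 := by
    rw [← pow_add, show a + (b + n) = 2 * r by omega, pow_mul]; simp
  have hb : (-1 : R) ^ (b + n) * (-1) ^ (b + n) = 1 := by
    rw [← pow_add, ← two_mul, pow_mul]; simp
  calc (-1 : R) ^ a = (-1) ^ a * ((-1) ^ (b + n) * (-1) ^ (b + n)) := by rw [hb, mul_one]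
    _ = ((-1) ^ a * (-1) ^ (b + n)) * (-1) ^ (b + n) := by ring
    _ = (-1) ^ (b + n) := by rw [h, one_mul]
    _ = (-1) ^ n * (-1) ^ b := by rw [pow_add]; ring

/-! ### §C — line 2 → line 3: «`(−1)^k ε_{K^c,K} = ε_{K,K^c}`» (p. 36 L51) -/

/-- The swap `e_{K^c} ∧ e_K = (−1)^{k(2n−k)} e_K ∧ e_{K^c}` has even exponent-difference with `k`:
`k(2n−k) + k` is even, i.e. `(−1)^{k(2n−k)} = (−1)^k`, whence «`ε_{K^c,K} = (−1)^k ε_{K,K^c}`» and line 3.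
[cite: Markman2025SecantWeil, proof of Lemma 6.3.1, v2 p. 36 L51; proof of Lemma 6.3.2, p. 38 L22–25] -/
theorem swap_parity (n k : ℕ) (hk : k ≤ 2 * n) : Even (k * (2 * n - k) + k) := by
  have : k * (2 * n - k) + k = k * (2 * n - k + 1) := by ring
  rw [this, Nat.even_mul]
  rcases Nat.even_or_odd k with h | h
  · exact Or.inl h
  · right; rw [Nat.even_iff]; rw [Nat.odd_iff] at h; omega

/-! ### §D — «`[k(k+1)+ℓ(ℓ+1)]/2`» and «`(−1)^{(k+ℓ)(k+ℓ+1)/2}(−1)^{kl}`» (L26–32) -/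

/-- The bracket splits exactly: `[k(k+1)+ℓ(ℓ+1)]/2 = k(k+1)/2 + ℓ(ℓ+1)/2`.
[cite: Markman2025SecantWeil, proof of Lemma 6.3.2, v2 p. 38 L22–30] -/
theorem bracket_split (k l : ℕ) :
    (k * (k + 1) + l * (l + 1)) / 2 = k * (k + 1) / 2 + l * (l + 1) / 2 :=
  Nat.add_div_of_dvd_right ((Nat.even_mul_succ_self k).two_dvd)

/-- «`(−1)^{[k(k+1)+ℓ(ℓ+1)]/2} = (−1)^{(k+ℓ)(k+ℓ+1)/2}(−1)^{kl}`» rests on the exact identity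
`(k+ℓ)(k+ℓ+1)/2 = k(k+1)/2 + ℓ(ℓ+1)/2 + kℓ`.
[cite: Markman2025SecantWeil, proof of Lemma 6.3.2, v2 p. 38 L30–32] -/
theorem triangle_of_sum (k l : ℕ) :
    (k + l) * (k + l + 1) / 2 = k * (k + 1) / 2 + l * (l + 1) / 2 + k * l := by
  have h1 := two_mul_triangle k
  have h2 := two_mul_triangle l
  have h3 := two_mul_triangle (k + l)
  have h4 : (k + l) * (k + l + 1) = k * (k + 1) + l * (l + 1) + 2 * (k * l) := by ring
  omega

/-- Hence the printed passage L30 → L32: `[k(k+1)+ℓ(ℓ+1)]/2 + (k+ℓ)(k+ℓ+1)/2 + kℓ` is even, i.e. the two signs agree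
up to `(−1)^{kl}`. [cite: Markman2025SecantWeil, proof of Lemma 6.3.2, v2 p. 38 L30–32] -/
theorem pairing_exponent (k l : ℕ) :
    Even ((k * (k + 1) + l * (l + 1)) / 2 + (k + l) * (k + l + 1) / 2 + k * l) := by
  rw [bracket_split, triangle_of_sum]
  exact ⟨k * (k + 1) / 2 + l * (l + 1) / 2 + k * l, by ring⟩

/-! ### §E — what line 1 gives for the operator sign -/

/-- Carrying LINE 1 (exponent `E₁`) through the printed steps — `ε_{K^c,K} = (−1)^k ε_{K,K^c}` (§C), the pairing with
`f_{L^c} ∧ e_{K^c}`, and `∫(f_L ∧ e_K) ∧ (f_{L^c} ∧ e_{K^c}) = (−1)^{kl}ε_{L,L^c}ε_{K,K^c}` (L36–39) — the operator sign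
exponent is `E₁ + k + kℓ`, and `E₁ + k + kℓ ≡ d(d+1)/2 + n` with `d = k + ℓ`: the statement would read
`(−1)^{d(d+1)/2+n}PD_{X̂×X}` on this reading (printed: `(−1)^{d(d+1)/2}`; equal for even `n`).
[cite: Markman2025SecantWeil, Lemma 6.3.2 and its proof, v2 p. 38 L8–L40] -/
theorem statement_exponent_from_line_one (n k l : ℕ) (hk : k ≤ 2 * n) :
    Even ((l * (l + 1) / 2 + n + ((2 * n - k) * (2 * n - k + 1) / 2 + n)) + k + k * l
      + ((k + l) * (k + l + 1) / 2 + n)) := by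
  obtain ⟨r, hr⟩ := line_one_line_two_gap n k l hk
  obtain ⟨s, hs⟩ := pairing_exponent k l
  refine ⟨r + s - (k * (k + 1) + l * (l + 1)) / 2, ?_⟩
  omega

/-! ### §F — the footnote-13 route -/

-- «k(k+3)/2 = k(k+1)/2 + k» (footnote 13's σ_K) is `Lemma631.sigma_exponent` of the landed module
-- `ChevalleyIsomorphismSigns` (imported; not restated here).

/-- If instead `ϕ_𝒫⁻¹(e_K)` is taken from p. 37 L3–5 (`Ψ_{𝒫⁻¹[n]}(e_K) = (−1)^{k(k+3)/2}ε_{K,K^c}f_{K^c}`, so that with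
`ε_{K,K^c} = (−1)^k ε_{K^c,K}` the second factor of line 1 carries the exponent `k(k+3)/2 + k`), the gap to line 2 is
`n + k` modulo 2: `[ℓ(ℓ+1)/2 + n + k(k+3)/2 + k] + [[k(k+1)+ℓ(ℓ+1)]/2 + k] + (n + k)` is even.
[cite: Markman2025SecantWeil, proof of Lemma 6.3.2, v2 p. 38 L18–23; p. 37 L3–5 and footnote 13] -/
theorem footnote13_route_gap (n k l : ℕ) :
    Even ((l * (l + 1) / 2 + n + (k * (k + 3) / 2 + k)) + ((k * (k + 1) + l * (l + 1)) / 2 + k) + (n + k)) := by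
  rw [bracket_split, Lemma631.sigma_exponent]
  exact ⟨l * (l + 1) / 2 + n + k * (k + 1) / 2 + k + k, by ring⟩

end Literature.AlgebraicGeometry.Markman2025.Lemma632
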